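import Mathlib

/-!
# Crux `HilbertIntegralOverconvergentIsCongruence` (stmt-Langlands-8485), line `Sketch-ideate-r1-k1`,
# section K (Götzky–Koecher): stub `stub_cubeIntegral_translate` (K-A1)

Section K of the line proves the Götzky–Koecher principle (Freitag, *Hilbert Modular Forms*, I.4.9)
for Fourier coefficients defined as integrals over the unit cube `[0,1]^ι` in integral-basis
coordinates.  This file proves the registered stub `stub_cubeIntegral_translate`: the integral over the
closed unit cube `Set.Icc 0 1 ⊆ ι → ℝ` of a `ℤ^ι`-periodic function `g : (ι → ℝ) → ℂ` is invariant
under translation of the argument, `∫_{[0,1]^ι} g (x + v) dx = ∫_{[0,1]^ι} g x dx`, with NO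
integrability or measurability hypothesis on `g`.

Proof.  The closed cube is a.e. equal to the half-open cube `C = ZSpan.fundamentalDomain (Pi.basisFun ℝ ι)`
(`Measure.univ_pi_Ico_ae_eq_Icc`), which is a fundamental domain for the lattice
`L = span ℤ (range (Pi.basisFun ℝ ι))` acting on `ι → ℝ` by translation
(`ZSpan.isAddFundamentalDomain'`).  By translation invariance of Lebesgue measure,
`∫_C g (x + v) dx = ∫_{C + v} g`, and `C + v` is again a fundamental domain for `L`
(`IsAddFundamentalDomain.mk'` from `ZSpan.exist_unique_vadd_mem_fundamentalDomain`).  The elements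
of `L` are exactly the integer vectors, so `g` is `L`-invariant, and
`IsAddFundamentalDomain.setIntegral_eq` (which needs no integrability: both sides vanish in the
non-integrable case) gives `∫_{C + v} g = ∫_C g`.
-/

set_option linter.dupNamespace false -- mandated namespace `Summit.Langlands.Langlands.…` repeats a component

namespace Summit.Langlands.Langlands.Theorems.HilbertIntegralOverconvergentIsCongruence

open MeasureTheory

/-- Elements of the `ℤ`-span of the standard basis of `ι → ℝ` are integer vectors. -/
theorem kA1_exists_intCast_eq_of_mem_span {ι : Type} [Fintype ι] {w : ι → ℝ}
    (hw : w ∈ Submodule.span ℤ (Set.range (Pi.basisFun ℝ ι))) :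
    ∃ m : ι → ℤ, (fun i ↦ (m i : ℝ)) = w := by
  choose z hz using ((Pi.basisFun ℝ ι).mem_span_iff_repr_mem ℤ w).mp hw
  exact ⟨z, funext fun i ↦ by simpa using hz i⟩

/-- The translate `C + v` of the half-open unit cube `C = ZSpan.fundamentalDomain (Pi.basisFun ℝ ι)`
is a fundamental domain for the translation action of the integer lattice on `ι → ℝ`. -/
theorem kA1_isAddFundamentalDomain_translate {ι : Type} [Fintype ι] (v : ι → ℝ) :
    IsAddFundamentalDomain (Submodule.span ℤ (Set.range (Pi.basisFun ℝ ι))).toAddSubgroup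
      ((fun x ↦ x + v) '' ZSpan.fundamentalDomain (Pi.basisFun ℝ ι)) volume := by
  -- prove it for the `Submodule` (same underlying type and action as its `toAddSubgroup`)
  suffices h : IsAddFundamentalDomain (Submodule.span ℤ (Set.range (Pi.basisFun ℝ ι)))
      ((fun x ↦ x + v) '' ZSpan.fundamentalDomain (Pi.basisFun ℝ ι)) volume from h
  rw [Set.image_add_right]
  refine IsAddFundamentalDomain.mk' ?_ fun x ↦ ?_
  · exact ((ZSpan.fundamentalDomain_measurableSet _).preimage
      (measurable_add_const _)).nullMeasurableSet
  · simpa only [Set.mem_preimage, Submodule.vadd_def, vadd_eq_add, add_assoc] using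
      ZSpan.exist_unique_vadd_mem_fundamentalDomain (Pi.basisFun ℝ ι) (x + -v)

/-- **stub K-A1 — `stub_cubeIntegral_translate`** (registered signature): the integral over the closed
unit cube `[0,1]^ι` of a `ℤ^ι`-periodic function `g : (ι → ℝ) → ℂ` is invariant under translation
of the argument by any `v : ι → ℝ` (no integrability hypothesis: both cubes `[0,1)^ι` and
`[0,1)^ι + v` are fundamental domains of `ℤ^ι`, and `[0,1]^ι =ᵐ [0,1)^ι`). -/
theorem stub_cubeIntegral_translate {ι : Type} [Fintype ι] (g : (ι → ℝ) → ℂ)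
    (hper : ∀ (m : ι → ℤ) (x : ι → ℝ), g (x + fun i ↦ (m i : ℝ)) = g x) (v : ι → ℝ) :
    ∫ x in Set.Icc (0 : ι → ℝ) 1, g (x + v) = ∫ x in Set.Icc (0 : ι → ℝ) 1, g x := by
  haveI : Countable (Submodule.span ℤ (Set.range (Pi.basisFun ℝ ι))).toAddSubgroup := by
    change Countable (Submodule.span ℤ (Set.range (Pi.basisFun ℝ ι)))
    infer_instance
  have hC : ZSpan.fundamentalDomain (Pi.basisFun ℝ ι) =ᵐ[volume] Set.Icc (0 : ι → ℝ) 1 := by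
    rw [ZSpan.fundamentalDomain_pi_basisFun]
    exact Measure.univ_pi_Ico_ae_eq_Icc (μ := fun _ : ι ↦ (volume : Measure ℝ)) (f := 0) (g := 1)
  have hinv : ∀ (w : (Submodule.span ℤ (Set.range (Pi.basisFun ℝ ι))).toAddSubgroup) (x : ι → ℝ),
      g (w +ᵥ x) = g x := by
    rintro ⟨w, hw⟩ x
    obtain ⟨m, rfl⟩ := kA1_exists_intCast_eq_of_mem_span hw
    rw [AddSubgroup.mk_vadd, vadd_eq_add, add_comm, hper]
  calc ∫ x in Set.Icc (0 : ι → ℝ) 1, g (x + v)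
      = ∫ x in ZSpan.fundamentalDomain (Pi.basisFun ℝ ι), g (x + v) :=
        (setIntegral_congr_set hC).symm
    _ = ∫ y in (fun x ↦ x + v) '' ZSpan.fundamentalDomain (Pi.basisFun ℝ ι), g y :=
        ((measurePreserving_add_right volume v).setIntegral_image_emb
          (measurableEmbedding_addRight v) g _).symm
    _ = ∫ x in ZSpan.fundamentalDomain (Pi.basisFun ℝ ι), g x :=
        (kA1_isAddFundamentalDomain_translate v).setIntegral_eq
          (ZSpan.isAddFundamentalDomain' (Pi.basisFun ℝ ι) volume) hinv
    _ = ∫ x in Set.Icc (0 : ι → ℝ) 1, g x := setIntegral_congr_set hC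

end Summit.Langlands.Langlands.Theorems.HilbertIntegralOverconvergentIsCongruence
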